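import Summits.Ventures.GridStability.Bench.GFMSMIBDeg2AQoriaV4physVlevR5K1910vRoaModel
import Summits.Ventures.GridStability.Bench.GFMSMIBDeg2AQoriaV4physK32Roa
import HarnessLib

/-!
# GFMSMIBDeg2AQoriaV4physVlevR5K1910vLever — the V LEVER in one place: NEW degree-2 `V` (level 1, declared ball `φ ≤ 5`) whose certified piece
# CONTAINS the arc-lever record piece `{V_rec ≤ 83} ∩ {φ ≤ 3}` (SMIB.gfmQoriaV4Phys; instrument «level ceiling / domain lever / V lever»)

Venture GRIDFUSION, LADDER T1 / X1 INSTRUMENT (memo §3.S2 lever order «domain, then V»), seat gridfusion-sos-5 (g9). This file only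
LINKS kernel objects already in the tree:
* the RECORD (arc-lever) certificate `GFM-SMIB-deg2-A-QoriaV4phys-k32` (Bench/GFMSMIBDeg2AQoriaV4physK32{Data,,Roa,Lever}.lean, ★ #230 «G3.a-ARC32-GFM-SMIB-DEG2-K32-LEVER-CERT»:
  the earlier degree-2 `V`, declared ball `φ ≤ 3`, certified level `83`; after it the binding identity of that `V` is
  `Vdot_neg` — the domain/arc lever is exhausted and «the next lever is V itself»);
* the V-LEVER certificate `GFM-SMIB-deg2-A-QoriaV4phys-vlevR5K1910v` (Bench/GFMSMIBDeg2AQoriaV4physVlevR5K1910v{Data,,Roa}.lean, sos-5 g9, kit j309357): a NEW degree-2 `V`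
  found by V–s alternation (HOME/cert/sos-5/vlever/valt.py — S-step: toolchain-A multipliers for `V` fixed; V-step: one SDP linear in `V`
  with the `(1 − V)`-multipliers frozen, objective the inscribed `φ`-ball radius; float and UNTRUSTED) and then RE-CERTIFIED exactly by
  toolchain A (level normalised to 1): `V_pos`, `Vdot_neg`, `level_in_ball` (`φ ≤ 5`, `φ = σ² + κ² + ω²/4500`), `arc_excl` (`κ ≤ 19/10`) + the inclusion
  identities `incl_record` and `shape_in`.

THREE COLUMNS. CERTIFIED (kernel, this file): (1) the two Bench objects have the same constraint `h` and the same recast vector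
field (`…_h_eq_record`, `…_f_…_eq_record`, `…_F_eq_record`: the `_eq` unfoldings + `ring`) — the SAME recast system, two
Lyapunov functions; (2) **RECORD PIECE ⊆ NEW PIECE** (`deg2_A_QoriaV4phys_vlevR5K1910v_record_piece_subset`): `h = 0 ∧ V_rec ≤ 83 ⇒ V ≤ 1` (the
Bench identity `incl_record`, its domain hypothesis `φ ≤ 3` discharged by the RECORD object's own `level_in_ball`); (3) the
inscribed ball (`deg2_A_QoriaV4phys_vlevR5K1910v_phi_ball_subset`): `h = 0 ∧ φ ≤ 21/20 ⇒ V ≤ 1` (Bench identity `shape_in`; for the record piece the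
same SDP finds `β ≈ 0.045` — VALIDATED, not certified); (4) STRICTNESS by an exact witness (`deg2_A_QoriaV4phys_vlevR5K1910v_witness`): the circle point
`z† = (-28/53, 98/53, 0)` (`u ≈ -148.1°`, at rest) has `h(z†) = 0`, `V(z†) ≤ 1` and `V_rec(z†) > 83` — inside the new piece, outside the
record piece; (5) the hypothesis-free ROA sentence for model-1's instance record at level 1 of the NEW `V`, and — through (2) — the
record sentence RE-DERIVED from the new certificate (`deg2_A_QoriaV4phys_vlevR5K1910v_gfmQoriaV4Phys_roa_record_piece`: every solution starting in the record
piece converges, now as a corollary of the new object). VALIDATED (float sampling of the two pieces on the angle chart `(u, ω)`, grid 1441 × 481, not a claim): u-range at `ω = 0` [-149.75, 146.25]° (record [-116.5, 119.0]°), extreme angles -153.25° at ω = 8.75 / 153.25° at ω = -13.417 (record -116.5° / 119.0°), ω-range at `u = 0` [-76.417, 76.417] (record [-14.0, 14.0]), fraction of the chart `|u| < 180°, |ω| ≤ 140` inside: 0.4222 (record 0.0742, ×5.69); max φ on the piece 4.1358 (record 2.9697). MODELLED: M′ = GFM-SMIB-QoriaV4-phys (reduced-order droop/VSM grid-forming inverter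 ≡ classical SMIB, physical time, `(a, b, d) = (233605208200/1873666673, 29431488000/1873666673, 33)`; MODEL-VALIDITY MV-6D+MV-P+MV-Ω; inner loops ABSENT, MV-INV-1); both pieces are INNER estimates of the
MODEL's region of attraction (SOS certificates are sufficient, not necessary); the positive-angle reach at `ω = 0` is capped by the
model's UEP at `u = π − 2δ^s ≈ 165.6°` for every Lyapunov function; nothing here is about a physical converter, machine or grid.
-/

namespace Summit.Ventures.GridStability.Bench.GFMSMIB

open Set Filter Topology Real
open Summit.Ventures.GridStability.Models
open Literature.Computation.Certificates Literature.Computation.Certificates.SOS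
open Literature.Computation.Certificates.SOS.Poly

/-! ### (1) Same constraint, same recast field as the record object (two Lyapunov functions, ONE system) -/

/-- Same polynomialisation constraint `h = σ² + κ² − 2κ` as the record object. [folklore] -/
theorem deg2_A_QoriaV4phys_vlevR5K1910v_h_eq_record (sigma kappa omega : ℝ) :
    deg2_A_QoriaV4phys_vlevR5K1910v_h sigma kappa omega = deg2_A_QoriaV4phys_k32_h sigma kappa omega := by
  rw [deg2_A_QoriaV4phys_vlevR5K1910v_h_eq, deg2_A_QoriaV4phys_k32_h_eq]

/-- Same recast vector field as the record object, component `σ̇`. [folklore] -/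
theorem deg2_A_QoriaV4phys_vlevR5K1910v_f_sigma_eq_record (sigma kappa omega : ℝ) :
    deg2_A_QoriaV4phys_vlevR5K1910v_f_sigma sigma kappa omega = deg2_A_QoriaV4phys_k32_f_sigma sigma kappa omega := by
  rw [deg2_A_QoriaV4phys_vlevR5K1910v_f_sigma_eq, deg2_A_QoriaV4phys_k32_f_sigma_eq]

/-- Same recast vector field as the record object, component `κ̇`. [folklore] -/
theorem deg2_A_QoriaV4phys_vlevR5K1910v_f_kappa_eq_record (sigma kappa omega : ℝ) :
    deg2_A_QoriaV4phys_vlevR5K1910v_f_kappa sigma kappa omega = deg2_A_QoriaV4phys_k32_f_kappa sigma kappa omega := by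
  rw [deg2_A_QoriaV4phys_vlevR5K1910v_f_kappa_eq, deg2_A_QoriaV4phys_k32_f_kappa_eq]

/-- Same recast vector field as the record object, component `ω̇`. [folklore] -/
theorem deg2_A_QoriaV4phys_vlevR5K1910v_f_omega_eq_record (sigma kappa omega : ℝ) :
    deg2_A_QoriaV4phys_vlevR5K1910v_f_omega sigma kappa omega = deg2_A_QoriaV4phys_k32_f_omega sigma kappa omega := by
  rw [deg2_A_QoriaV4phys_vlevR5K1910v_f_omega_eq, deg2_A_QoriaV4phys_k32_f_omega_eq]

/-- Hence the same recast system on `Fin 3 → ℝ` (the two Roa companions' fields coincide). [folklore] -/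
theorem deg2_A_QoriaV4phys_vlevR5K1910v_F_eq_record :
    deg2_A_QoriaV4phys_vlevR5K1910v_F = deg2_A_QoriaV4phys_k32_F := by
  funext z i
  fin_cases i <;>
    simp [deg2_A_QoriaV4phys_vlevR5K1910v_F, deg2_A_QoriaV4phys_k32_F, deg2_A_QoriaV4phys_vlevR5K1910v_f_sigma_eq_record,
      deg2_A_QoriaV4phys_vlevR5K1910v_f_kappa_eq_record, deg2_A_QoriaV4phys_vlevR5K1910v_f_omega_eq_record]

/-! ### (2) The record piece lies inside the new piece -/

/-- **RECORD PIECE ⊆ NEW PIECE** (CERTIFIED): on the constraint set, `V_rec ≤ 83` implies `V ≤ 1` — the kernel identity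
`deg2_A_QoriaV4phys_vlevR5K1910v_incl_record` (hypotheses: `83 − V_rec ≥ 0` as an explicit polynomial, the record ball `3 − φ ≥ 0`, `h = 0`), with
the record ball hypothesis discharged by the RECORD object's certified `level_in_ball` and `V_rec` identified through the record
file's `_V_eq`. So every initial condition certified by ★ #230 is certified here too. [folklore] -/
theorem deg2_A_QoriaV4phys_vlevR5K1910v_record_piece_subset (sigma kappa omega : ℝ) (hh : deg2_A_QoriaV4phys_k32_h sigma kappa omega = 0)
    (hV : deg2_A_QoriaV4phys_k32_V sigma kappa omega ≤ (83 : ℝ)) :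
    deg2_A_QoriaV4phys_vlevR5K1910v_V sigma kappa omega ≤ (1 : ℝ) := by
  have hb := deg2_A_QoriaV4phys_k32_level_in_ball sigma kappa omega hV hh
  have hh' : deg2_A_QoriaV4phys_vlevR5K1910v_h sigma kappa omega = 0 := by rw [deg2_A_QoriaV4phys_vlevR5K1910v_h_eq_record]; exact hh
  rw [deg2_A_QoriaV4phys_k32_V_eq] at hV
  have h := deg2_A_QoriaV4phys_vlevR5K1910v_incl_record sigma kappa omega (by linarith) (by linarith) hh'
  rw [deg2_A_QoriaV4phys_vlevR5K1910v_V_eq]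
  linarith

/-! ### (3) The inscribed `φ`-ball -/

/-- **INSCRIBED BALL** (CERTIFIED): on the constraint set, `φ = σ² + κ² + ω²/36 ≤ 21/20` implies `V ≤ 1` (kernel identity
`deg2_A_QoriaV4phys_vlevR5K1910v_shape_in`; `β = 21/20` = the alternation's inscribed radius backed off 3 % and rounded before the exact re-certification). [folklore] -/
theorem deg2_A_QoriaV4phys_vlevR5K1910v_phi_ball_subset (sigma kappa omega : ℝ) (hh : deg2_A_QoriaV4phys_vlevR5K1910v_h sigma kappa omega = 0)
    (hφ : sigma ^ 2 + kappa ^ 2 + omega ^ 2 / 4500 ≤ (21 / 20 : ℝ)) :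
    deg2_A_QoriaV4phys_vlevR5K1910v_V sigma kappa omega ≤ (1 : ℝ) := by
  have h := deg2_A_QoriaV4phys_vlevR5K1910v_shape_in sigma kappa omega (by linarith) hh
  rw [deg2_A_QoriaV4phys_vlevR5K1910v_V_eq]
  linarith

/-! ### (4) Strictness: an exact point of the new piece outside the record piece -/

/-- **STRICTLY LARGER** (exact arithmetic): the circle point `z† = (-28/53, 98/53, 0)` (relative angle `u ≈ -148.11°`, `ω = 0`)
satisfies `h(z†) = 0`, `V(z†) ≤ 1` (it is in the new certified piece, on which `V̇ ≤ −φ/200000`, `φ ≤ 5`, `κ ≤ 19/10` are kernel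
facts) and `83 < V_rec(z†)` (it is NOT in the record piece). [folklore] -/
theorem deg2_A_QoriaV4phys_vlevR5K1910v_witness :
    deg2_A_QoriaV4phys_vlevR5K1910v_h (-28/53) (98/53) 0 = 0 ∧
      deg2_A_QoriaV4phys_vlevR5K1910v_V (-28/53) (98/53) 0 ≤ (1 : ℝ) ∧
        (83 : ℝ) < deg2_A_QoriaV4phys_k32_V (-28/53) (98/53) 0 := by
  refine ⟨?_, ?_, ?_⟩
  · rw [deg2_A_QoriaV4phys_vlevR5K1910v_h_eq]; norm_num
  · rw [deg2_A_QoriaV4phys_vlevR5K1910v_V_eq]; norm_num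
  · rw [deg2_A_QoriaV4phys_k32_V_eq]; norm_num

/-! ### (5) The ROA sentences: level 1 of the new `V`, and the record piece re-derived from the new certificate -/

/-- **V LEVER, HYPOTHESIS-FREE READING** (MODELLED: M′ = GFM-SMIB-QoriaV4-phys (reduced-order droop/VSM grid-forming inverter ≡ classical SMIB, physical time, `(a, b, d) = (233605208200/1873666673, 29431488000/1873666673, 33)`; MODEL-VALIDITY MV-6D+MV-P+MV-Ω; inner loops ABSENT, MV-INV-1), instance record `SMIB.gfmQoriaV4Phys`): for every solution
`x = (δ, ω)` of `SMIB.gfmQoriaV4Phys` on `[0, ∞)` with `V(sin u₀, 1 − cos u₀, ω₀) ≤ 1` and `|u₀| < π` (`u = δ − δ^s`, `V` = the NEW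
degree-2 `V`): `V ≤ 1` and `|u t| < π` for all `t ≥ 0`, and `(δ t, ω t) → (δ^s, 0)` (= the Roa companion's theorem at `γ = 1`).
INNER estimate for the MODEL; no sentence here says a converter, machine or grid is stable. [folklore] -/
theorem deg2_A_QoriaV4phys_vlevR5K1910v_gfmQoriaV4Phys_roa_one
    {x : ℝ → ℝ × ℝ} (hx : SMIB.gfmQoriaV4Phys.IsSolutionOn x (Ici 0))
    (h0V : deg2_A_QoriaV4phys_vlevR5K1910v_V (sin ((x 0).1 - SMIB.deltaQV4)) (1 - cos ((x 0).1 - SMIB.deltaQV4)) (x 0).2 ≤ (1 : ℝ))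
    (h0win : |(x 0).1 - SMIB.deltaQV4| < π) :
    (∀ t, 0 ≤ t → deg2_A_QoriaV4phys_vlevR5K1910v_V (sin ((x t).1 - SMIB.deltaQV4)) (1 - cos ((x t).1 - SMIB.deltaQV4)) (x t).2 ≤ (1 : ℝ) ∧
        |(x t).1 - SMIB.deltaQV4| < π) ∧ Tendsto x atTop (𝓝 (SMIB.deltaQV4, 0)) :=
  deg2_A_QoriaV4phys_vlevR5K1910v_gfmQoriaV4Phys_roa (γ := (1 : ℝ)) one_pos le_rfl hx h0V h0win

/-- **THE RECORD SENTENCE AS A COROLLARY OF THE NEW CERTIFICATE** (MODELLED as above): every solution of `SMIB.gfmQoriaV4Phys` on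
`[0, ∞)` that starts in the RECORD piece — `V_rec(sin u₀, 1 − cos u₀, ω₀) ≤ 83`, `|u₀| < π`, `V_rec` = the record degree-2 `V` of
Bench/GFMSMIBDeg2AQoriaV4physK32.lean — stays in the NEW piece (`V ≤ 1`), never pole-slips and converges to `(δ^s, 0)`: by (2) the initial
state lies in the new piece, then `deg2_A_QoriaV4phys_vlevR5K1910v_gfmQoriaV4Phys_roa_one`. (The record companion proves invariance of the record piece itself;
here the record piece is only the set of initial conditions.) [folklore] -/
theorem deg2_A_QoriaV4phys_vlevR5K1910v_gfmQoriaV4Phys_roa_record_piece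
    {x : ℝ → ℝ × ℝ} (hx : SMIB.gfmQoriaV4Phys.IsSolutionOn x (Ici 0))
    (h0V : deg2_A_QoriaV4phys_k32_V (sin ((x 0).1 - SMIB.deltaQV4)) (1 - cos ((x 0).1 - SMIB.deltaQV4)) (x 0).2 ≤ (83 : ℝ))
    (h0win : |(x 0).1 - SMIB.deltaQV4| < π) :
    (∀ t, 0 ≤ t → deg2_A_QoriaV4phys_vlevR5K1910v_V (sin ((x t).1 - SMIB.deltaQV4)) (1 - cos ((x t).1 - SMIB.deltaQV4)) (x t).2 ≤ (1 : ℝ) ∧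
        |(x t).1 - SMIB.deltaQV4| < π) ∧ Tendsto x atTop (𝓝 (SMIB.deltaQV4, 0)) := by
  have hM := deg2_A_QoriaV4phys_k32_embed_mem_M SMIB.deltaQV4 (x 0)
  have hh : deg2_A_QoriaV4phys_k32_h (sin ((x 0).1 - SMIB.deltaQV4)) (1 - cos ((x 0).1 - SMIB.deltaQV4)) (x 0).2 = 0 := by
    simpa [deg2_A_QoriaV4phys_k32_M, SMIB.embed] using hM
  exact deg2_A_QoriaV4phys_vlevR5K1910v_gfmQoriaV4Phys_roa_one hx (deg2_A_QoriaV4phys_vlevR5K1910v_record_piece_subset _ _ _ hh h0V) h0win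

end Summit.Ventures.GridStability.Bench.GFMSMIB
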